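import Literature.NumberTheory.Rogawski1990.UnitFundamentalLemmaSplitPlace
import Literature.NumberTheory.Rogawski1990.LocalTransferSplitPlaceClasses
import Literature.NumberTheory.Rogawski1990.GRegularLocalisation
import Literature.NumberTheory.Rogawski1990.RegularEltLocalisation
import Literature.NumberTheory.Automorphic.GLnLeviOrbitalDescentCanonicalOne
import Literature.NumberTheory.Automorphic.GLnStandardLeviTwoOnePoint
import Literature.NumberTheory.Automorphic.CompactCoreLevelPoint
import Literature.NumberTheory.Automorphic.LocalOrbitalIntegralIndicator
import Literature.NumberTheory.Automorphic.UnitaryGroupOrbitalMeasureOfLocalQuotient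
import HarnessLib

/-!
# [Rogawski1990 §4.9 Prop. 4.9.1 (b)] The unit fundamental lemma at a place SPLIT in `L`, the two LEVI SIDES:
# both unit orbital integrals — on `G′_v = U(H′)_v` and on `H_v = U(Φ₂)_v × U(Φ₁)_v` — are ONE orbital integral on `M = GL₂ × GL₁ ⊂ GL₃(L_w)`
(Rogawski (1990), §4.9 Prop. 4.9.1 (b) p. 55 «`Δ_{G∕H}(γ)Φ^κ(γ, f) = Φ^st(γ, f^H)` where `f` and `f^H` are the units of the Hecke algebras»;
§4.13 Lemma 4.13.1 (a) p. 64 `Φ^G(γ, f) = |D_{G∕M}(γ)|^{−1∕2} Φ^M(γ, f̄^P)`; §4.4 p. 44, §4.3 (4.3.1) p. 43: `vol(K) = 1`, compatible measures)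

Topic `NumberTheory/Rogawski1990`; namespaces `Literature.NumberTheory.Automorphic` (§0, generic) and `Literature.NumberTheory.Rogawski1990`
(§1–§2).  THEOREMS ONLY (no definition, no instance, no notation, no named fact, no `sorry`).  Cell `pub/hodgecm-mathlib`, programme P3a,
letter **N7 (#103)** ★ `UnitFundamentalLemmaExplicitClosed`, row «D-N7s-G2» FILE A (LEAD F0P3a-plan (g8) T7-39 (B) ∕ T7-53).  The letter's local
clause at `v` is ★ `IsLocalUnitTransfer L H′ v T mH mG`; at a split `v` it is ONE identity per matching pair `γ_H → γ₀` (★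
`isLocalUnitTransfer_iff_forall_isLocalNormPair_of_split`, p838654): `Φ([γ_H], 1_{K_H}; mH) = Δ‴_v(γ_H, γ₀) · Φ([γ₀], 1_{K′}; mG)`.  This file
computes the two class orbital integrals for CANONICAL families `mH`, `mG` (★ `OrbitalMeasureFamily.IsCanonical`, read AT THE POINT by ★
`IsCanonical.atPoint_eq_quotientMeasure`) as ONE `[0, ∞]`-valued orbital integral `I_M(p)` on the standard Levi subgroup
`M = M_{(2,1)} ⊂ GL₃(L_w)` at `p = diag(g_w, u_w)` (`g_w = e₂ γ_H.1`, `u_w = e₁ γ_H.2`, ★ `localSplitEquiv`), against the canonical quotient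
`ν_M ∕ t_M` of a Haar measure `ν_M` with `ν_M(M ∩ GL₃(𝒪_w)) = 1` by THE Haar measure `t_M` on `C_M(p)` with mass one on its compact core:

* §0 generic plumbing: `map_apply_compactCore_eq_one_of_homeomorph` (mass one on the compact core transports along a multiplicative
  homeomorphism), `lintegral_descConj_indicator_one` ∕ `orbitalIntegral_indicator_eq_ofReal_toReal_lintegral` (the `[0,∞]` and the `ℂ`
  reading of the orbital integral of `1_K`), `reindexGL_finSumFinEquiv_blockDiagGL_mem_glInt_iff` (`diag(x₁, x₂) ∈ GL(𝒪) ↔ x₁, x₂ ∈ GL(𝒪)`).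
* §1 **`classOrbitalIntegral_unit_eq_weyl_mul_levi_of_split`** — the `G′`-side: for `γ₁ ∈ G′_v` regular with `e′ γ₁ = p = diag(g, u) ∈ M`,
  `Φ([γ₁], 1_{K′}; mG) = ((‖det(1 − K_p)‖⁻¹ ‖det K_p‖ · I_M(p)).toReal : ℂ)` — ★ `lintegral_descConj_quotientMeasure_eq_lintegral_levi_of_measure_eq_one`
  (p838905, parabolic descent with constant ONE) along ★ D-S1d, the inner `K × U` integral being `1_{K_M}` (★ `lintegral_prod_indicator_glInt_conj_levi_mul`),
  the algebraic binders from ★ `GLnStandardLeviTwoOnePoint` (`C_{GL₃}(p) ≤ M`, `det(1 − K_p) ≠ 0`).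
* §2 **`classOrbitalIntegral_unit_eq_levi_of_split_H`** — the `H`-side: for `γ_H ∈ H_v` `G`-regular and `p = diag(e₂ γ_H.1, e₁ γ_H.2)`,
  `Φ([γ_H], 1_{K_H}; mH) = ((I_M(p)).toReal : ℂ)` — transport along `j̃ = eM ∘ (e₂ × e₁) : H_v ≃ M` (★ `exists_continuousMulEquiv_prod_standardLeviGL_twoBlock`).
In both, the normalising measure on `C_M(p)` born by transport is identified with `t_M` by Haar uniqueness at the compact core (★
`isHaarMeasure_eq_of_apply_eq` at the compact core, ★ `image_compactCore`).  FILE B («D-N7s-G2» §3–§4, `UnitFundamentalLemmaSplitPlaceIdentity`) multiplies by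
`Δ‴_v = μ_w(det g_w) · ‖det(1 − K_p)‖ · ‖det K_p‖^{−1∕2}` (★ D-S2s, ★ D-S2r, ★ B6) and concludes.  GL-side instances (σ-algebras, second countability, local
compactness) are BINDERS as in ★ p838905; the split-place isomorphisms enter in the (b3) convention `(e′ : (cmDatum L 3 H′).Local v ≃ₜ* GL₃(L_w))
(he′ : e′ = localSplitEquiv …)` of ★ `UnitaryGroupLocalTorusPackage` (the `cmDatum` carriers are not reducible).  Nothing at non-split places.  HONEST LABEL: HC_CM is proved only modulo the printed
citations (2 remaining named inputs hLiu418, h413) until rung 0 closes; this file discharges none of them.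

## References
* [Rogawski1990] J. D. Rogawski, *Automorphic Representations of Unitary Groups in Three Variables*, Ann. of Math. Stud. 123 (1990), §4.9
  Prop. 4.9.1 (b) p. 55; §4.13 Lemma 4.13.1 (a) p. 64; §4.3 (4.3.1) p. 43; §4.4 p. 44; §14.2 p. 232.
* [DeitmarEchterhoff2014] A. Deitmar, S. Echterhoff, *Principles of Harmonic Analysis*, 2nd ed. (2014), Thm. 1.5.3.
* [BernsteinZelevinsky1977] I. N. Bernstein, A. V. Zelevinsky, *Induced representations of reductive `p`-adic groups I*, Ann. Sci. ÉNS 10 (1977), §2.1.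
* [PlatonovRapinchuk1994] V. Platonov, A. Rapinchuk, *Algebraic Groups and Number Theory* (1994), §5.1.
* [BourbakiGT1] N. Bourbaki, *General Topology*, Ch. III §2.
-/

set_option autoImplicit false

noncomputable section

open MeasureTheory Measure Set NumberField IsDedekindDomain Literature.MeasureTheory.Group
open scoped ENNReal NNReal Matrix MatrixGroups

namespace Literature.NumberTheory.Automorphic

/-! ## §0 Generic plumbing -/

section CompactCoreTransport

variable {Z Z' : Type*} [Group Z] [Group Z'] [TopologicalSpace Z] [TopologicalSpace Z']
  [MeasurableSpace Z] [BorelSpace Z] [MeasurableSpace Z'] [BorelSpace Z']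

/-- **Mass one on the compact core transports** along a multiplicative homeomorphism `f : Z ≃ₜ Z′` of topological groups:
`t(compactCore Z) = 1 ⇒ (f_* t)(compactCore Z′) = 1` (★ `image_compactCore`). [cite: Rogawski1990, §4.3 (4.3.1) p. 43] [cite: BourbakiGT1, Ch. III §2] -/
theorem map_apply_compactCore_eq_one_of_homeomorph (f : Z ≃ₜ Z') (hf : ∀ a b, f (a * b) = f a * f b) (t : Measure Z)
    (h1 : t (compactCore Z) = 1) : Measure.map f t (compactCore Z') = 1 := by
  let e : Z ≃ₜ* Z' :=
    { toMulEquiv := { toEquiv := f.toEquiv, map_mul' := hf }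
      continuous_toFun := f.continuous
      continuous_invFun := f.symm.continuous }
  have he : (e : Z → Z') = f := rfl
  rw [← Homeomorph.toMeasurableEquiv_coe, MeasurableEquiv.map_apply, Homeomorph.toMeasurableEquiv_coe]
  have hpre : (f : Z → Z') ⁻¹' compactCore Z' = compactCore Z := by
    rw [← he, Set.preimage_eq_iff_eq_image e.bijective, image_compactCore e]
  rw [hpre, h1]

end CompactCoreTransport

section IndicatorReading

variable {G : Type*} [Group G] [TopologicalSpace G] [IsTopologicalGroup G] (γ : G) {M : Subgroup G} (hM : ∀ m ∈ M, m * γ = γ * m)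
  [MeasurableSpace (G ⧸ M)] [BorelSpace (G ⧸ M)] (m : Measure (G ⧸ M))

/-- **The `[0, ∞]`-valued orbital integral of `1_K` is the measure of the preimage of `K` under the orbit map**:
`∫⁻ 1_K(y γ y⁻¹) dm(y) = m {yM ∣ y γ y⁻¹ ∈ K}` for an open `K` (★ `descConj_indicator`). [cite: Rogawski1990, §4.9 p. 54] -/
theorem lintegral_descConj_indicator_one {K : Set G} (hK : IsOpen K) :
    ∫⁻ y, descConj γ M hM (K.indicator fun _ => (1 : ℝ≥0∞)) y ∂m = m (descConj γ M hM id ⁻¹' K) := by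
  rw [descConj_indicator, lintegral_indicator_const ((hK.preimage (continuous_descConj_id γ M hM)).measurableSet), one_mul]

variable [MeasurableSpace (G ⧸ Subgroup.centralizer ({γ} : Set G))] [BorelSpace (G ⧸ Subgroup.centralizer ({γ} : Set G))]
  (μ : Measure (G ⧸ Subgroup.centralizer ({γ} : Set G)))

/-- **The complex unit orbital integral is the real part of the `[0, ∞]`-valued one**: for an open `K`,
`O_γ(1_K; μ) = ((∫⁻ 1_K(y γ y⁻¹) dμ).toReal : ℂ)` (both are `μ{y ∣ y γ y⁻¹ ∈ K}`, ★ `integral_descConj_indicator`). [cite: Rogawski1990, §4.9 p. 54] -/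
theorem orbitalIntegral_indicator_eq_ofReal_toReal_lintegral {K : Set G} (hK : IsOpen K) :
    orbitalIntegral γ (K.indicator fun _ => (1 : ℂ)) μ =
      ((∫⁻ y, descConj γ (Subgroup.centralizer ({γ} : Set G)) (fun _ hg => Subgroup.mem_centralizer_singleton_iff.1 hg)
        (K.indicator fun _ => (1 : ℝ≥0∞)) y ∂μ).toReal : ℂ) := by
  rw [orbitalIntegral_eq_integral_descConj, integral_descConj_indicator γ μ hK (1 : ℂ), lintegral_descConj_indicator_one γ _ μ hK,
    Complex.real_smul, mul_one]

end IndicatorReading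

section BlockDiag

open ValuativeRel

variable {F : Type*} [Field F] [ValuativeRel F] {k l : ℕ}

/-- **`diag(x₁, x₂) ∈ GL_{k+l}(𝒪) ↔ x₁ ∈ GL_k(𝒪) ∧ x₂ ∈ GL_l(𝒪)`** for the standard two-block element
`reindexGL finSumFinEquiv (blockDiagGL (x₁, x₂))` (entries of the matrix and of its inverse are those of the blocks, and zeros).
[cite: PlatonovRapinchuk1994, §5.1] [cite: BernsteinZelevinsky1977, §2.1] -/
theorem reindexGL_finSumFinEquiv_blockDiagGL_mem_glInt_iff (x : GL (Fin k) F × GL (Fin l) F) :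
    UnitaryGroup.reindexGL finSumFinEquiv (UnitaryGroup.blockDiagGL x) ∈ glInt (k + l) F ↔
      x.1 ∈ glInt k F ∧ x.2 ∈ glInt l F := by
  have hinv : (UnitaryGroup.reindexGL finSumFinEquiv (UnitaryGroup.blockDiagGL x))⁻¹ =
      UnitaryGroup.reindexGL finSumFinEquiv (UnitaryGroup.blockDiagGL x⁻¹) := by
    rw [map_inv, map_inv]
  have hentry : ∀ (y : GL (Fin k) F × GL (Fin l) F) (s t : Fin k ⊕ Fin l),
      ((UnitaryGroup.reindexGL finSumFinEquiv (UnitaryGroup.blockDiagGL y) : GL (Fin (k + l)) F) : Matrix (Fin (k + l)) (Fin (k + l)) F)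
          (finSumFinEquiv s) (finSumFinEquiv t) =
        Matrix.fromBlocks (y.1 : Matrix (Fin k) (Fin k) F) 0 0 (y.2 : Matrix (Fin l) (Fin l) F) s t := fun y s t => by
    rw [UnitaryGroup.coe_reindexGL, Matrix.reindex_apply, Matrix.submatrix_apply, Equiv.symm_apply_apply,
      Equiv.symm_apply_apply, UnitaryGroup.coe_blockDiagGL]
  -- all entries of `diag(y)` integral ↔ all entries of the blocks integral
  have hall : ∀ y : GL (Fin k) F × GL (Fin l) F,
      (∀ i j, ((UnitaryGroup.reindexGL finSumFinEquiv (UnitaryGroup.blockDiagGL y) : GL (Fin (k + l)) F) : Matrix (Fin (k + l)) (Fin (k + l)) F) i j ∈ 𝒪[F]) ↔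
        (∀ a a', (y.1 : Matrix (Fin k) (Fin k) F) a a' ∈ 𝒪[F]) ∧ (∀ b b', (y.2 : Matrix (Fin l) (Fin l) F) b b' ∈ 𝒪[F]) := by
    intro y
    constructor
    · intro h
      refine ⟨fun a a' => ?_, fun b b' => ?_⟩
      · have h1 := h (finSumFinEquiv (Sum.inl a)) (finSumFinEquiv (Sum.inl a'))
        rwa [hentry, Matrix.fromBlocks_apply₁₁] at h1
      · have h1 := h (finSumFinEquiv (Sum.inr b)) (finSumFinEquiv (Sum.inr b'))
        rwa [hentry, Matrix.fromBlocks_apply₂₂] at h1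
    · rintro ⟨h₁, h₂⟩ i j
      obtain ⟨s, rfl⟩ := finSumFinEquiv.surjective i
      obtain ⟨t, rfl⟩ := finSumFinEquiv.surjective j
      rw [hentry]
      rcases s with a | b <;> rcases t with a' | b'
      · rw [Matrix.fromBlocks_apply₁₁]; exact h₁ a a'
      · rw [Matrix.fromBlocks_apply₁₂]; exact zero_mem _
      · rw [Matrix.fromBlocks_apply₂₁]; exact zero_mem _
      · rw [Matrix.fromBlocks_apply₂₂]; exact h₂ b b'
  rw [mem_glInt_iff, hinv, hall, hall, mem_glInt_iff, mem_glInt_iff, Prod.fst_inv, Prod.snd_inv]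
  tauto

end BlockDiag

end Literature.NumberTheory.Automorphic


/-! ## §1 The `G′`-side: `Φ([γ₁], 1_{K′}; mG) = ‖det(1 − K_p)‖⁻¹ ‖det K_p‖ · I_M(p)` -/

namespace Literature.NumberTheory.Rogawski1990

open Literature.NumberTheory.Automorphic Literature.NumberTheory.Automorphic.UnitaryGroup
open Literature.NumberTheory.GaloisRepresentations.IsNonarchimedeanLocalField

section Split

variable (L : Type) [Field L] [NumberField L] [IsCMField L] (H' : Matrix (Fin 3) (Fin 3) L)
  {v : HeightOneSpectrum (𝓞 ↥(maximalRealSubfield L))}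
  (w : UnitaryGroup.PlacesOver L v) (hw : IsCMField.complexConj L • w.1 ≠ w.1)
  (hH' : (H'.map (IsCMField.complexConj L))ᵀ = H') (hH'w : IsUnit (placeForm H' w.1))
  -- σ-algebras on the unitary carriers and their centraliser quotients (the letter's `borel` ones in the application)
  [MeasurableSpace ((UnitaryGroup.cmDatum L 3 H').Local v)] [BorelSpace ((UnitaryGroup.cmDatum L 3 H').Local v)]
  [∀ γ : (UnitaryGroup.cmDatum L 3 H').Local v,
    MeasurableSpace ((UnitaryGroup.cmDatum L 3 H').Local v ⧸ Subgroup.centralizer ({γ} : Set ((UnitaryGroup.cmDatum L 3 H').Local v)))]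
  [∀ γ : (UnitaryGroup.cmDatum L 3 H').Local v,
    BorelSpace ((UnitaryGroup.cmDatum L 3 H').Local v ⧸ Subgroup.centralizer ({γ} : Set ((UnitaryGroup.cmDatum L 3 H').Local v)))]
  -- the GL-side carriers at `w` (instances are BINDERS, ★ `locallyCompactSpace_gl_adicCompletion` ∕ `secondCountableTopology_gl_adicCompletion`)
  [MeasurableSpace (w.1.adicCompletion L)] [BorelSpace (w.1.adicCompletion L)]
  [MeasurableSpace (GL (Fin 3) (w.1.adicCompletion L))] [BorelSpace (GL (Fin 3) (w.1.adicCompletion L))]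
  [LocallyCompactSpace (GL (Fin 3) (w.1.adicCompletion L))] [SecondCountableTopology (GL (Fin 3) (w.1.adicCompletion L))]
  [LocallyCompactSpace ↥(standardLeviGL (w.1.adicCompletion L) (fun i : Fin 3 => decide (2 ≤ (i : ℕ))))]
  -- the Levi point `p = diag(g, u)` and the canonical `M`-side measures
  (g : GL (Fin 2) (w.1.adicCompletion L)) (u : GL (Fin 1) (w.1.adicCompletion L))
  (p : standardParabolicGL (w.1.adicCompletion L) (fun i : Fin 3 => decide (2 ≤ (i : ℕ))))
  (hp : (p : GL (Fin 3) (w.1.adicCompletion L)) = UnitaryGroup.reindexGL finSumFinEquiv (UnitaryGroup.blockDiagGL (g, u)))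
  (hpM : (p : GL (Fin 3) (w.1.adicCompletion L)) ∈ standardLeviGL (w.1.adicCompletion L) (fun i : Fin 3 => decide (2 ≤ (i : ℕ))))
  (hT : IsClosed ((Subgroup.centralizer ({(p : GL (Fin 3) (w.1.adicCompletion L))} : Set (GL (Fin 3) (w.1.adicCompletion L))) :
    Subgroup (GL (Fin 3) (w.1.adicCompletion L))) : Set (GL (Fin 3) (w.1.adicCompletion L))))
  [MeasurableSpace (↥(standardLeviGL (w.1.adicCompletion L) (fun i : Fin 3 => decide (2 ≤ (i : ℕ)))) ⧸
    (Subgroup.centralizer ({(p : GL (Fin 3) (w.1.adicCompletion L))} : Set (GL (Fin 3) (w.1.adicCompletion L)))).subgroupOf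
      (standardLeviGL (w.1.adicCompletion L) (fun i : Fin 3 => decide (2 ≤ (i : ℕ)))))]
  [BorelSpace (↥(standardLeviGL (w.1.adicCompletion L) (fun i : Fin 3 => decide (2 ≤ (i : ℕ)))) ⧸
    (Subgroup.centralizer ({(p : GL (Fin 3) (w.1.adicCompletion L))} : Set (GL (Fin 3) (w.1.adicCompletion L)))).subgroupOf
      (standardLeviGL (w.1.adicCompletion L) (fun i : Fin 3 => decide (2 ≤ (i : ℕ)))))]
  (νM : Measure ↥(standardLeviGL (w.1.adicCompletion L) (fun i : Fin 3 => decide (2 ≤ (i : ℕ)))))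
  [νM.IsHaarMeasure] [νM.IsMulRightInvariant] [νM.IsInvInvariant]
  (hνM : νM (Subtype.val ⁻¹' (glInt 3 (w.1.adicCompletion L) : Set (GL (Fin 3) (w.1.adicCompletion L)))) = 1)
  (tM : Measure ↥((Subgroup.centralizer ({(p : GL (Fin 3) (w.1.adicCompletion L))} : Set (GL (Fin 3) (w.1.adicCompletion L)))).subgroupOf
      (standardLeviGL (w.1.adicCompletion L) (fun i : Fin 3 => decide (2 ≤ (i : ℕ))))))
  [tM.IsHaarMeasure] [tM.IsInvInvariant]
  (htM : tM (compactCore _) = 1)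

set_option maxHeartbeats 400000 in
include hp hT hνM htM in
/-- **The `G′`-side of the unit identity at a split place** (Rogawski 1990, Lemma 4.13.1 (a) at the unit of the Hecke algebra, with the
normalisations of §4.4 — constant ONE, ★ `lintegral_descConj_quotientMeasure_eq_lintegral_levi_of_measure_eq_one`).  Let `mG` be CANONICAL for
`(IsRegularElt, νG)` with `νG(K′) = 1` (`K′ = U(H′)(𝒪_v)`, `H′_w ∈ GL₃(𝒪_w)`), and `γ₁ ∈ G′_v = U(H′)_v` regular with `e′ γ₁ = p = diag(g, u) ∈ M`
(★ `localSplitEquiv`).  Then for every Haar measure `ν_M` on `M` with `ν_M(M ∩ GL₃(𝒪_w)) = 1` and THE Haar measure `t_M` on `C_M(p) = C(p) ⊓ M`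
with mass one on its compact core,
`Φ([γ₁], 1_{K′}; mG) = ((‖det(1 − K_p)‖⁻¹ ‖det K_p‖ · ∫⁻_{M ⧸ C_M(p)} 1_{GL₃(𝒪_w)}(m p m⁻¹) d(ν_M ∕ t_M)).toReal : ℂ)`
— read at the point (★ `IsCanonical.atPoint_eq_quotientMeasure`), transported to `GL₃(L_w)` (★ `lintegral_descConj_quotientMeasure_eq_of_mulEquiv_of_eq`,
★ `indicator_glInt_comp_localSplitEquiv`), descended to `M` (`C(p) ≤ M`, `det(1 − K_p) ≠ 0`: ★ `GLnStandardLeviTwoOnePoint`), the inner `K × U`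
integral being `1_{GL₃(𝒪_w)}` on `M` (★ `lintegral_prod_indicator_glInt_conj_levi_mul`), and the transported centraliser measure identified with
`t_M` by Haar uniqueness at the compact core. [cite: Rogawski1990, §4.9 Prop. 4.9.1 (b) p. 55; §4.13 Lemma 4.13.1 (a) p. 64; §4.4 p. 44]
[cite: DeitmarEchterhoff2014, Thm. 1.5.3] -/
theorem classOrbitalIntegral_unit_eq_weyl_mul_levi_of_split (hH'i : hH'w.unit ∈ glInt 3 (w.1.adicCompletion L))
    (νG : Measure ((UnitaryGroup.cmDatum L 3 H').Local v)) [νG.IsHaarMeasure] [νG.IsMulRightInvariant]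
    (hKG : νG (UnitaryGroup.cmLocalIntegralLevel L 3 H' v : Set ((UnitaryGroup.cmDatum L 3 H').Local v)) = 1)
    (mG : OrbitalMeasureFamily ((UnitaryGroup.cmDatum L 3 H').Local v))
    (hmG : mG.IsCanonical (fun γ => IsRegularElt (γ.val : GL (Fin 3) (UnitaryGroup.LocalRing L v))) νG)
    (e' : (UnitaryGroup.cmDatum L 3 H').Local v ≃ₜ* GL (Fin 3) (w.1.adicCompletion L))
    (he' : e' = localSplitEquiv (IsCMField.complexConj L) H' (IsCMField.complexConj_ne_one L) hH' w hw hH'w)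
    (γ₁ : (UnitaryGroup.cmDatum L 3 H').Local v) (hreg : IsRegularElt (γ₁.val : GL (Fin 3) (UnitaryGroup.LocalRing L v)))
    (hγ₁ : e' γ₁ = UnitaryGroup.reindexGL finSumFinEquiv (UnitaryGroup.blockDiagGL (g, u))) :
    classOrbitalIntegral mG ((UnitaryGroup.cmLocalIntegralLevel L 3 H' v : Set ((UnitaryGroup.cmDatum L 3 H').Local v)).indicator
        fun _ => (1 : ℂ)) (ConjClasses.mk γ₁) =
      (((((normAbs (w.1.adicCompletion L) ((1 - Matrix.of
              fun q q' : {i : Fin 3 // decide (2 ≤ (i : ℕ)) = false} × {j : Fin 3 // decide (2 ≤ (j : ℕ)) = true} =>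
                ((p : GL (Fin 3) (w.1.adicCompletion L)) : Matrix (Fin 3) (Fin 3) (w.1.adicCompletion L)) q.1 q'.1 *
                  (((p⁻¹ : standardParabolicGL (w.1.adicCompletion L) (fun i : Fin 3 => decide (2 ≤ (i : ℕ)))) :
                    GL (Fin 3) (w.1.adicCompletion L)) : Matrix (Fin 3) (Fin 3) (w.1.adicCompletion L)) q'.2 q.2).det)⁻¹ *
            normAbs (w.1.adicCompletion L) (Matrix.of
              fun q q' : {i : Fin 3 // decide (2 ≤ (i : ℕ)) = false} × {j : Fin 3 // decide (2 ≤ (j : ℕ)) = true} =>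
                ((p : GL (Fin 3) (w.1.adicCompletion L)) : Matrix (Fin 3) (Fin 3) (w.1.adicCompletion L)) q.1 q'.1 *
                  (((p⁻¹ : standardParabolicGL (w.1.adicCompletion L) (fun i : Fin 3 => decide (2 ≤ (i : ℕ)))) :
                    GL (Fin 3) (w.1.adicCompletion L)) : Matrix (Fin 3) (Fin 3) (w.1.adicCompletion L)) q'.2 q.2).det : ℝ≥0) : ℝ≥0∞) *
          ∫⁻ z, descConj (⟨(p : GL (Fin 3) (w.1.adicCompletion L)), hpM⟩ :
                ↥(standardLeviGL (w.1.adicCompletion L) (fun i : Fin 3 => decide (2 ≤ (i : ℕ)))))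
              ((Subgroup.centralizer ({(p : GL (Fin 3) (w.1.adicCompletion L))} : Set (GL (Fin 3) (w.1.adicCompletion L)))).subgroupOf
                (standardLeviGL (w.1.adicCompletion L) (fun i : Fin 3 => decide (2 ≤ (i : ℕ)))))
              (fun _ hs => Subtype.ext (Subgroup.mem_centralizer_singleton_iff.1 hs))
              (fun m : ↥(standardLeviGL (w.1.adicCompletion L) (fun i : Fin 3 => decide (2 ≤ (i : ℕ)))) =>
                (glInt 3 (w.1.adicCompletion L) : Set (GL (Fin 3) (w.1.adicCompletion L))).indicator (fun _ => (1 : ℝ≥0∞))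
                  (m : GL (Fin 3) (w.1.adicCompletion L)))
              z ∂(quotientMeasure _ tM (isClosed_subgroupOf _ _ hT) νM)).toReal : ℝ) : ℂ) := by
  -- (0) algebra of the Levi point `p = diag(g, u)` (★ `GLnStandardLeviTwoOnePoint`)
  have hregGL : IsRegularElt (UnitaryGroup.reindexGL finSumFinEquiv (UnitaryGroup.blockDiagGL (g, u))) := by
    rw [← hγ₁, he']
    exact isRegularElt_localSplitEquiv_of_isRegularElt (IsCMField.complexConj L) w H' (IsCMField.complexConj_ne_one L) hw
      hH' hH'w γ₁ hreg
  have hdet := det_sub_ne_zero_of_isRegularElt_reindexGL_blockDiagGL 2 finSumFinEquiv g u hregGL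
  have hTM : Subgroup.centralizer ({(p : GL (Fin 3) (w.1.adicCompletion L))} : Set (GL (Fin 3) (w.1.adicCompletion L))) ≤
      standardLeviGL (w.1.adicCompletion L) (fun i : Fin 3 => decide (2 ≤ (i : ℕ))) := by
    rw [hp]; exact centralizer_le_standardLeviGL_of_det_sub_ne_zero 2 g u hdet
  have hpbox := det_one_sub_boxAd_ne_zero_of_det_sub_ne_zero 2 g u hdet p hp
  have hpT : ∀ s ∈ Subgroup.centralizer ({(p : GL (Fin 3) (w.1.adicCompletion L))} : Set (GL (Fin 3) (w.1.adicCompletion L))),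
      s * (p : GL (Fin 3) (w.1.adicCompletion L)) = (p : GL (Fin 3) (w.1.adicCompletion L)) * s :=
    fun s hs => Subgroup.mem_centralizer_singleton_iff.1 hs
  have hmono : Monotone (fun i : Fin 3 => decide (2 ≤ (i : ℕ))) := by decide
  have hMc : IsClosed ((standardLeviGL (w.1.adicCompletion L) (fun i : Fin 3 => decide (2 ≤ (i : ℕ))) :
      Subgroup (GL (Fin 3) (w.1.adicCompletion L))) : Set (GL (Fin 3) (w.1.adicCompletion L))) :=
    isClosed_standardLeviGL (R := w.1.adicCompletion L) _
  -- (1) read the class orbital integral at the point `γ₁` against the canonical quotient measure `νG ∕ tG`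
  have hout : IsRegularElt ((Quotient.out (ConjClasses.mk γ₁)).val : GL (Fin 3) (UnitaryGroup.LocalRing L v)) :=
    isRegularElt_out_mk_local hreg
  haveI := hmG.isAdmissibleOn.smulInvariantMeasure (c := ConjClasses.mk γ₁) hout
  obtain ⟨tG, htG, htGi, htG1, hat⟩ := hmG.atPoint_eq_quotientMeasure γ₁ hout
  rw [← OrbitalMeasureFamily.orbitalIntegral_atPoint mG γ₁, hat,
    orbitalIntegral_indicator_eq_ofReal_toReal_lintegral γ₁ _ (UnitaryGroup.isCompact_isOpen_cmLocalIntegralLevel L 3 H' v).2]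
  refine congrArg (fun r : ℝ≥0∞ => ((r.toReal : ℝ) : ℂ)) ?_
  -- (2) instances on the centralisers and the GL-side quotients
  haveI hCγ : IsClosed ((Subgroup.centralizer ({γ₁} : Set ((UnitaryGroup.cmDatum L 3 H').Local v)) :
      Subgroup ((UnitaryGroup.cmDatum L 3 H').Local v)) : Set ((UnitaryGroup.cmDatum L 3 H').Local v)) :=
    isClosed_coe_centralizer_singleton γ₁
  haveI : LocallyCompactSpace (Subgroup.centralizer ({γ₁} : Set ((UnitaryGroup.cmDatum L 3 H').Local v))) :=
    hCγ.isClosedEmbedding_subtypeVal.locallyCompactSpace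
  haveI : SecondCountableTopology (Subgroup.centralizer ({γ₁} : Set ((UnitaryGroup.cmDatum L 3 H').Local v))) :=
    TopologicalSpace.Subtype.secondCountableTopology _
  haveI := htG
  haveI := htGi
  haveI hTc : IsClosed ((Subgroup.centralizer ({(p : GL (Fin 3) (w.1.adicCompletion L))} : Set (GL (Fin 3) (w.1.adicCompletion L))) :
      Subgroup (GL (Fin 3) (w.1.adicCompletion L))) : Set (GL (Fin 3) (w.1.adicCompletion L))) := hT
  haveI : LocallyCompactSpace (Subgroup.centralizer ({(p : GL (Fin 3) (w.1.adicCompletion L))} : Set (GL (Fin 3) (w.1.adicCompletion L)))) :=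
    hT.isClosedEmbedding_subtypeVal.locallyCompactSpace
  haveI : SecondCountableTopology (Subgroup.centralizer ({(p : GL (Fin 3) (w.1.adicCompletion L))} : Set (GL (Fin 3) (w.1.adicCompletion L)))) :=
    TopologicalSpace.Subtype.secondCountableTopology _
  letI : MeasurableSpace (GL (Fin 3) (w.1.adicCompletion L) ⧸
      Subgroup.centralizer ({(p : GL (Fin 3) (w.1.adicCompletion L))} : Set (GL (Fin 3) (w.1.adicCompletion L)))) := borel _
  haveI : BorelSpace (GL (Fin 3) (w.1.adicCompletion L) ⧸
      Subgroup.centralizer ({(p : GL (Fin 3) (w.1.adicCompletion L))} : Set (GL (Fin 3) (w.1.adicCompletion L)))) := ⟨rfl⟩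
  letI : MeasurableSpace (GL (Fin 3) (w.1.adicCompletion L) ⧸ standardLeviGL (w.1.adicCompletion L) (fun i : Fin 3 => decide (2 ≤ (i : ℕ)))) :=
    borel _
  haveI : BorelSpace (GL (Fin 3) (w.1.adicCompletion L) ⧸ standardLeviGL (w.1.adicCompletion L) (fun i : Fin 3 => decide (2 ≤ (i : ℕ)))) :=
    ⟨rfl⟩
  haveI : BorelSpace ↥(standardLeviGL (w.1.adicCompletion L) (fun i : Fin 3 => decide (2 ≤ (i : ℕ)))) := Subtype.borelSpace _
  haveI : BorelSpace ↥((Subgroup.centralizer ({(p : GL (Fin 3) (w.1.adicCompletion L))} : Set (GL (Fin 3) (w.1.adicCompletion L)))).subgroupOf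
      (standardLeviGL (w.1.adicCompletion L) (fun i : Fin 3 => decide (2 ≤ (i : ℕ))))) := Subtype.borelSpace _
  haveI hTMc : IsClosed ((((Subgroup.centralizer ({(p : GL (Fin 3) (w.1.adicCompletion L))} :
      Set (GL (Fin 3) (w.1.adicCompletion L)))).subgroupOf (standardLeviGL (w.1.adicCompletion L) (fun i : Fin 3 => decide (2 ≤ (i : ℕ))))) :
      Subgroup ↥(standardLeviGL (w.1.adicCompletion L) (fun i : Fin 3 => decide (2 ≤ (i : ℕ))))) :
      Set ↥(standardLeviGL (w.1.adicCompletion L) (fun i : Fin 3 => decide (2 ≤ (i : ℕ))))) := isClosed_subgroupOf _ _ hT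
  haveI : LocallyCompactSpace ↥((Subgroup.centralizer ({(p : GL (Fin 3) (w.1.adicCompletion L))} :
      Set (GL (Fin 3) (w.1.adicCompletion L)))).subgroupOf (standardLeviGL (w.1.adicCompletion L) (fun i : Fin 3 => decide (2 ≤ (i : ℕ))))) :=
    hTMc.isClosedEmbedding_subtypeVal.locallyCompactSpace
  haveI : SecondCountableTopology ↥((Subgroup.centralizer ({(p : GL (Fin 3) (w.1.adicCompletion L))} :
      Set (GL (Fin 3) (w.1.adicCompletion L)))).subgroupOf (standardLeviGL (w.1.adicCompletion L) (fun i : Fin 3 => decide (2 ≤ (i : ℕ))))) :=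
    TopologicalSpace.Subtype.secondCountableTopology _
  -- (3) the measures transported to `GL₃(L_w)` along `e′`
  have hTT' : ∀ x, e'.toMulEquiv x ∈
      Subgroup.centralizer ({(p : GL (Fin 3) (w.1.adicCompletion L))} : Set (GL (Fin 3) (w.1.adicCompletion L))) ↔
        x ∈ Subgroup.centralizer ({γ₁} : Set ((UnitaryGroup.cmDatum L 3 H').Local v)) :=
    forall_apply_mem_centralizer_singleton_iff_of_eq _ (hγ₁.trans hp.symm)
  have hcont : Continuous e'.toMulEquiv := e'.continuous
  have hcont' : Continuous e'.toMulEquiv.symm := e'.symm.continuous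
  let φ := subgroupCongrHomeomorph e'.toMulEquiv (Subgroup.centralizer ({γ₁} : Set ((UnitaryGroup.cmDatum L 3 H').Local v)))
    (Subgroup.centralizer ({(p : GL (Fin 3) (w.1.adicCompletion L))} : Set (GL (Fin 3) (w.1.adicCompletion L)))) hTT' hcont hcont'
  have hex₃ : ∃ t₃ : Measure ↥(Subgroup.centralizer ({(p : GL (Fin 3) (w.1.adicCompletion L))} : Set (GL (Fin 3) (w.1.adicCompletion L)))),
      t₃ = Measure.map φ tG := ⟨Measure.map φ tG, rfl⟩
  obtain ⟨t₃, ht₃⟩ := hex₃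
  haveI : t₃.IsHaarMeasure := by rw [ht₃]; exact isHaarMeasure_map_subgroupCongrHomeomorph _ _ _ _ _ _ tG
  haveI : t₃.IsInvInvariant := by rw [ht₃]; exact isInvInvariant_map_subgroupCongrHomeomorph _ _ _ _ _ _ tG
  have hexν : ∃ ν₃ : Measure (GL (Fin 3) (w.1.adicCompletion L)), ν₃ = Measure.map e' νG := ⟨Measure.map e' νG, rfl⟩
  obtain ⟨ν₃, hν₃⟩ := hexν
  haveI : ν₃.IsHaarMeasure := by rw [hν₃]; exact ContinuousMulEquiv.isHaarMeasure_map νG _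
  haveI : ν₃.IsMulRightInvariant := by
    rw [hν₃]
    exact isMulRightInvariant_map_mulEquiv_of_isMulRightInvariant e'.toMulEquiv hcont.measurable νG
  have hν₃K : ν₃ (glInt 3 (w.1.adicCompletion L) : Set (GL (Fin 3) (w.1.adicCompletion L))) = 1 := by
    rw [hν₃, map_continuousMulEquiv_apply]
    have hpre : ⇑e' ⁻¹' (glInt 3 (w.1.adicCompletion L) : Set (GL (Fin 3) (w.1.adicCompletion L))) =
        (UnitaryGroup.cmLocalIntegralLevel L 3 H' v : Set ((UnitaryGroup.cmDatum L 3 H').Local v)) := by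
      ext x
      rw [Set.mem_preimage, he']
      exact (mem_localIntegralLevel_iff_of_ne (IsCMField.complexConj L) 3 H' (IsCMField.complexConj_ne_one L) hH' w hw
        hH'w hH'i x).symm
    rw [hpre, hKG]
  -- (4) transport the `G′`-side integral to `GL₃(L_w)` (★ (n7-i) §0)
  have hind : ((glInt 3 (w.1.adicCompletion L) : Set (GL (Fin 3) (w.1.adicCompletion L))).indicator fun _ => (1 : ℝ≥0∞)) ∘
        ⇑e'.toMulEquiv =
      (UnitaryGroup.cmLocalIntegralLevel L 3 H' v : Set ((UnitaryGroup.cmDatum L 3 H').Local v)).indicator fun _ => (1 : ℝ≥0∞) := by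
    rw [he']
    exact indicator_glInt_comp_localSplitEquiv (IsCMField.complexConj L) 3 H' (IsCMField.complexConj_ne_one L) hH' w hw hH'w hH'i _
  have hC := lintegral_descConj_quotientMeasure_eq_of_mulEquiv_of_eq e'.toMulEquiv hcont hcont'
    (Subgroup.centralizer ({γ₁} : Set ((UnitaryGroup.cmDatum L 3 H').Local v)))
    (Subgroup.centralizer ({(p : GL (Fin 3) (w.1.adicCompletion L))} : Set (GL (Fin 3) (w.1.adicCompletion L)))) hTT'
    tG t₃ νG ν₃ ht₃ hν₃ (hγ₁.trans hp.symm) (fun _ hg => Subgroup.mem_centralizer_singleton_iff.1 hg) hpT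
    ((glInt 3 (w.1.adicCompletion L) : Set (GL (Fin 3) (w.1.adicCompletion L))).indicator fun _ => (1 : ℝ≥0∞))
  rw [hind] at hC
  refine Eq.trans hC.symm ?_
  -- (5) Haar measures on `K = GL₃(𝒪_w)` and on `U` with the volume-one normalisations
  haveI : LocallyCompactSpace ↥(glInt 3 (w.1.adicCompletion L)) :=
    (isCompact_glInt 3 (w.1.adicCompletion L)).isClosed.isClosedEmbedding_subtypeVal.locallyCompactSpace
  haveI : BorelSpace ↥(glInt 3 (w.1.adicCompletion L)) := Subtype.borelSpace _
  haveI : CompactSpace ↥(glInt 3 (w.1.adicCompletion L)) := isCompact_iff_compactSpace.1 (isCompact_glInt 3 (w.1.adicCompletion L))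
  have hKex := exists_isHaarMeasure_apply_eq_one (G := ↥(glInt 3 (w.1.adicCompletion L))) (s := Set.univ) isCompact_univ
    (by rw [interior_univ]; exact Set.univ_nonempty)
  obtain ⟨κ, hκH, hκ⟩ := hKex
  haveI := hκH
  have hUK : IsCompact (Subtype.val ⁻¹' (glInt 3 (w.1.adicCompletion L) : Set (GL (Fin 3) (w.1.adicCompletion L))) :
      Set ↥(unipotentRadicalGL (w.1.adicCompletion L) (fun i : Fin 3 => decide (2 ≤ (i : ℕ))))) :=
    (isClosed_unipotentRadicalGL (R := w.1.adicCompletion L) (fun i : Fin 3 => decide (2 ≤ (i : ℕ)))).isClosedEmbedding_subtypeVal.isCompact_preimage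
      (isCompact_glInt 3 (w.1.adicCompletion L))
  have hUo : IsOpen (Subtype.val ⁻¹' (glInt 3 (w.1.adicCompletion L) : Set (GL (Fin 3) (w.1.adicCompletion L))) :
      Set ↥(unipotentRadicalGL (w.1.adicCompletion L) (fun i : Fin 3 => decide (2 ≤ (i : ℕ))))) :=
    (isOpen_glInt 3 (w.1.adicCompletion L)).preimage continuous_subtype_val
  haveI : LocallyCompactSpace ↥(unipotentRadicalGL (w.1.adicCompletion L) (fun i : Fin 3 => decide (2 ≤ (i : ℕ)))) :=
    (isClosed_unipotentRadicalGL (R := w.1.adicCompletion L) (fun i : Fin 3 => decide (2 ≤ (i : ℕ)))).isClosedEmbedding_subtypeVal.locallyCompactSpace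
  haveI : BorelSpace ↥(unipotentRadicalGL (w.1.adicCompletion L) (fun i : Fin 3 => decide (2 ≤ (i : ℕ)))) := Subtype.borelSpace _
  have hUex := exists_isHaarMeasure_apply_eq_one hUK
    (by rw [hUo.interior_eq]; exact ⟨1, (glInt 3 (w.1.adicCompletion L)).one_mem⟩)
  obtain ⟨μU, hμUH, hμU⟩ := hUex
  haveI := hμUH
  -- (6) the normalising measure on `C_M(p)`: `t_M` IS the transport of `t₃` (Haar uniqueness at the compact core)
  have h3c : t₃ (compactCore _) = 1 := by
    rw [ht₃]
    exact map_apply_compactCore_eq_one_of_homeomorph _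
      (fun a b => Subtype.ext (by simp only [φ, coe_subgroupCongrHomeomorph_apply, Subgroup.coe_mul, map_mul])) tG htG1
  let fs : ↥(Subgroup.centralizer ({(p : GL (Fin 3) (w.1.adicCompletion L))} : Set (GL (Fin 3) (w.1.adicCompletion L)))) ≃ₜ
      ↥((Subgroup.centralizer ({(p : GL (Fin 3) (w.1.adicCompletion L))} : Set (GL (Fin 3) (w.1.adicCompletion L)))).subgroupOf
        (standardLeviGL (w.1.adicCompletion L) (fun i : Fin 3 => decide (2 ≤ (i : ℕ))))) :=
    { toEquiv := (Subgroup.subgroupOfEquivOfLe hTM).symm.toEquiv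
      continuous_toFun := continuous_subgroupOfEquivOfLe_symm _ _ hTM
      continuous_invFun := continuous_subgroupOfEquivOfLe _ _ hTM }
  have hfs : (⇑fs : _ → _) = ⇑(Subgroup.subgroupOfEquivOfLe hTM).symm := rfl
  haveI : (Measure.map (Subgroup.subgroupOfEquivOfLe hTM).symm t₃).IsHaarMeasure :=
    MulEquiv.isHaarMeasure_map t₃ _ (continuous_subgroupOfEquivOfLe_symm _ _ hTM) (continuous_subgroupOfEquivOfLe _ _ hTM)
  haveI : (Measure.map (Subgroup.subgroupOfEquivOfLe hTM).symm t₃).IsInvInvariant :=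
    isInvInvariant_map_mulEquiv _ (continuous_subgroupOfEquivOfLe_symm _ _ hTM).measurable t₃
  have hs1 : (Measure.map (Subgroup.subgroupOfEquivOfLe hTM).symm t₃) (compactCore _) = 1 := by
    rw [← hfs]
    exact map_apply_compactCore_eq_one_of_homeomorph fs (fun a b => rfl) t₃ h3c
  have htM' : tM = Measure.map (Subgroup.subgroupOfEquivOfLe hTM).symm t₃ :=
    isHaarMeasure_eq_of_apply_eq tM _ (by rw [hs1]; exact one_ne_zero) (by rw [hs1]; exact ENNReal.one_ne_top) (by rw [htM, hs1])
  -- (7) parabolic descent with constant ONE (★ p838905)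
  have hdesc := lintegral_descConj_quotientMeasure_eq_lintegral_levi_of_measure_eq_one (w.1.adicCompletion L) hmono rfl hMc
    ν₃ νM κ μU hν₃K hνM hκ hμU _ hT hTM t₃ tM htM' p hpM hpT hpbox
    ((measurable_const : Measurable fun _ : GL (Fin 3) (w.1.adicCompletion L) => (1 : ℝ≥0∞)).indicator
      (isOpen_glInt 3 (w.1.adicCompletion L)).measurableSet)
  refine Eq.trans hdesc ?_
  -- (8) the inner `K × U` integral of `1_K` is `1_K` on `M` (★ `lintegral_prod_indicator_glInt_conj_levi_mul`)
  have hμU' : μU {x : ↥(unipotentRadicalGL (w.1.adicCompletion L) (fun i : Fin 3 => decide (2 ≤ (i : ℕ)))) |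
      (x : GL (Fin 3) (w.1.adicCompletion L)) ∈ glInt 3 (w.1.adicCompletion L)} = 1 := hμU
  refine congrArg₂ (· * ·) rfl ?_
  refine lintegral_congr fun z => ?_
  induction z using QuotientGroup.induction_on with
  | H y =>
    rw [descConj_mk, descConj_mk]
    have h := lintegral_prod_indicator_glInt_conj_levi_mul κ μU
      (y * (⟨(p : GL (Fin 3) (w.1.adicCompletion L)), hpM⟩ : ↥(standardLeviGL (w.1.adicCompletion L)
        (fun i : Fin 3 => decide (2 ≤ (i : ℕ))))) * y⁻¹).2
    rw [hκ, hμU', one_mul, one_mul] at h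
    exact h


/-! ## §2 The `H`-side: `Φ([γ_H], 1_{K_H}; mH) = I_M(p)` along `j̃ = eM ∘ (e₂ × e₁) : H_v ≃ M` -/

section HSide

variable
  [MeasurableSpace ((UnitaryGroup.cmDatum L 2 (Matrix.of fun i j : Fin 2 => if i.val + j.val + 1 = 2 then (1 : L) else 0)).Local v ×
      (UnitaryGroup.cmDatum L 1 (Matrix.of fun i j : Fin 1 => if i.val + j.val + 1 = 1 then (1 : L) else 0)).Local v)]
  [BorelSpace ((UnitaryGroup.cmDatum L 2 (Matrix.of fun i j : Fin 2 => if i.val + j.val + 1 = 2 then (1 : L) else 0)).Local v ×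
      (UnitaryGroup.cmDatum L 1 (Matrix.of fun i j : Fin 1 => if i.val + j.val + 1 = 1 then (1 : L) else 0)).Local v)]
  [∀ a : ((UnitaryGroup.cmDatum L 2 (Matrix.of fun i j : Fin 2 => if i.val + j.val + 1 = 2 then (1 : L) else 0)).Local v ×
      (UnitaryGroup.cmDatum L 1 (Matrix.of fun i j : Fin 1 => if i.val + j.val + 1 = 1 then (1 : L) else 0)).Local v),
    MeasurableSpace (((UnitaryGroup.cmDatum L 2 (Matrix.of fun i j : Fin 2 => if i.val + j.val + 1 = 2 then (1 : L) else 0)).Local v ×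
      (UnitaryGroup.cmDatum L 1 (Matrix.of fun i j : Fin 1 => if i.val + j.val + 1 = 1 then (1 : L) else 0)).Local v) ⧸
      Subgroup.centralizer ({a} : Set ((UnitaryGroup.cmDatum L 2 (Matrix.of fun i j : Fin 2 => if i.val + j.val + 1 = 2 then (1 : L) else 0)).Local v ×
      (UnitaryGroup.cmDatum L 1 (Matrix.of fun i j : Fin 1 => if i.val + j.val + 1 = 1 then (1 : L) else 0)).Local v)))]
  [∀ a : ((UnitaryGroup.cmDatum L 2 (Matrix.of fun i j : Fin 2 => if i.val + j.val + 1 = 2 then (1 : L) else 0)).Local v ×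
      (UnitaryGroup.cmDatum L 1 (Matrix.of fun i j : Fin 1 => if i.val + j.val + 1 = 1 then (1 : L) else 0)).Local v),
    BorelSpace (((UnitaryGroup.cmDatum L 2 (Matrix.of fun i j : Fin 2 => if i.val + j.val + 1 = 2 then (1 : L) else 0)).Local v ×
      (UnitaryGroup.cmDatum L 1 (Matrix.of fun i j : Fin 1 => if i.val + j.val + 1 = 1 then (1 : L) else 0)).Local v) ⧸
      Subgroup.centralizer ({a} : Set ((UnitaryGroup.cmDatum L 2 (Matrix.of fun i j : Fin 2 => if i.val + j.val + 1 = 2 then (1 : L) else 0)).Local v ×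
      (UnitaryGroup.cmDatum L 1 (Matrix.of fun i j : Fin 1 => if i.val + j.val + 1 = 1 then (1 : L) else 0)).Local v)))]

set_option maxHeartbeats 400000 in
omit [MeasurableSpace (w.1.adicCompletion L)] [BorelSpace (w.1.adicCompletion L)] [LocallyCompactSpace (GL (Fin 3) (w.1.adicCompletion L))]
  [νM.IsInvInvariant] in
include hT hνM htM in
/-- **The `H`-side of the unit identity at a split place.**  Let `mH` be CANONICAL for `(IsLocalGRegular, νH)` on `H_v = U(Φ₂)_v × U(Φ₁)_v` with
`νH(K_H) = 1` (`K_H = U(Φ₂)(𝒪_v) × U(Φ₁)(𝒪_v)`), `γ_H ∈ H_v` `G`-regular, and `p = diag(e₂ γ_H.1, e₁ γ_H.2) ∈ M` (`e₂`, `e₁` the split-place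
isomorphisms ★ `localSplitEquiv` of `U(Φ₂)_v`, `U(Φ₁)_v`, in the (b3) convention «equivalence as a binder with its equation»).  Then for every Haar
measure `ν_M` on `M` with `ν_M(M ∩ GL₃(𝒪_w)) = 1` and THE Haar measure `t_M` on `C_M(p)` with mass one on its compact core,
`Φ([γ_H], 1_{K_H}; mH) = ((∫⁻_{M ⧸ C_M(p)} 1_{GL₃(𝒪_w)}(m p m⁻¹) d(ν_M ∕ t_M)).toReal : ℂ)` — read at the point (★ `IsCanonical.atPoint_eq_quotientMeasure`) and
transported along `j̃ := eM ∘ (e₂ × e₁) : H_v ≃ₜ* M` (★ `exists_continuousMulEquiv_prod_standardLeviGL_twoBlock`, ★ `lintegral_descConj_quotientMeasure_eq_of_mulEquiv_of_eq`),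
`j̃(K_H) = M ∩ GL₃(𝒪_w)` (★ `mem_localIntegralLevel_iff_of_ne`, `reindexGL_finSumFinEquiv_blockDiagGL_mem_glInt_iff`), the transported Haar measures being `ν_M` and
`t_M` by uniqueness of the normalisations (★ `isHaarMeasure_eq_of_apply_eq`, `map_apply_compactCore_eq_one_of_homeomorph`).
[cite: Rogawski1990, §4.9 Prop. 4.9.1 (b) p. 55; §4.13 Lemma 4.13.1 (a) p. 64; §4.3 (4.3.1) p. 43] [cite: DeitmarEchterhoff2014, Thm. 1.5.3] -/
theorem classOrbitalIntegral_unit_eq_levi_of_split_H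
    (νH : Measure ((UnitaryGroup.cmDatum L 2 (Matrix.of fun i j : Fin 2 => if i.val + j.val + 1 = 2 then (1 : L) else 0)).Local v ×
      (UnitaryGroup.cmDatum L 1 (Matrix.of fun i j : Fin 1 => if i.val + j.val + 1 = 1 then (1 : L) else 0)).Local v)) [νH.IsHaarMeasure] [νH.IsMulRightInvariant]
    (hKH : νH (((UnitaryGroup.cmLocalIntegralLevel L 2 (Matrix.of fun i j : Fin 2 => if i.val + j.val + 1 = 2 then (1 : L) else 0) v).prod
        (UnitaryGroup.cmLocalIntegralLevel L 1 (Matrix.of fun i j : Fin 1 => if i.val + j.val + 1 = 1 then (1 : L) else 0) v) : Subgroup ((UnitaryGroup.cmDatum L 2 (Matrix.of fun i j : Fin 2 => if i.val + j.val + 1 = 2 then (1 : L) else 0)).Local v ×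
      (UnitaryGroup.cmDatum L 1 (Matrix.of fun i j : Fin 1 => if i.val + j.val + 1 = 1 then (1 : L) else 0)).Local v)) : Set ((UnitaryGroup.cmDatum L 2 (Matrix.of fun i j : Fin 2 => if i.val + j.val + 1 = 2 then (1 : L) else 0)).Local v ×
      (UnitaryGroup.cmDatum L 1 (Matrix.of fun i j : Fin 1 => if i.val + j.val + 1 = 1 then (1 : L) else 0)).Local v)) = 1)
    (mH : OrbitalMeasureFamily ((UnitaryGroup.cmDatum L 2 (Matrix.of fun i j : Fin 2 => if i.val + j.val + 1 = 2 then (1 : L) else 0)).Local v ×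
      (UnitaryGroup.cmDatum L 1 (Matrix.of fun i j : Fin 1 => if i.val + j.val + 1 = 1 then (1 : L) else 0)).Local v))
    (hmH : mH.IsCanonical (IsLocalGRegular L v) νH)
    (e₂ : (UnitaryGroup.cmDatum L 2 (Matrix.of fun i j : Fin 2 => if i.val + j.val + 1 = 2 then (1 : L) else 0)).Local v ≃ₜ* GL (Fin 2) (w.1.adicCompletion L))
    (he₂ : e₂ = localSplitEquiv (IsCMField.complexConj L) _ (IsCMField.complexConj_ne_one L)
      (antidiagOne_map_transpose (IsCMField.complexConj L) 2) w hw (isUnit_placeForm_antidiagOne 2 w.1))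
    (e₁ : (UnitaryGroup.cmDatum L 1 (Matrix.of fun i j : Fin 1 => if i.val + j.val + 1 = 1 then (1 : L) else 0)).Local v ≃ₜ* GL (Fin 1) (w.1.adicCompletion L))
    (he₁ : e₁ = localSplitEquiv (IsCMField.complexConj L) _ (IsCMField.complexConj_ne_one L)
      (antidiagOne_map_transpose (IsCMField.complexConj L) 1) w hw (isUnit_placeForm_antidiagOne 1 w.1))
    (γH : ((UnitaryGroup.cmDatum L 2 (Matrix.of fun i j : Fin 2 => if i.val + j.val + 1 = 2 then (1 : L) else 0)).Local v ×
      (UnitaryGroup.cmDatum L 1 (Matrix.of fun i j : Fin 1 => if i.val + j.val + 1 = 1 then (1 : L) else 0)).Local v))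
    (hreg : IsLocalGRegular L v γH)
    (hpH : (p : GL (Fin 3) (w.1.adicCompletion L)) = UnitaryGroup.reindexGL finSumFinEquiv (UnitaryGroup.blockDiagGL (e₂ γH.1, e₁ γH.2))) :
    classOrbitalIntegral mH ((((UnitaryGroup.cmLocalIntegralLevel L 2 (Matrix.of fun i j : Fin 2 => if i.val + j.val + 1 = 2 then (1 : L) else 0) v).prod
        (UnitaryGroup.cmLocalIntegralLevel L 1 (Matrix.of fun i j : Fin 1 => if i.val + j.val + 1 = 1 then (1 : L) else 0) v) : Subgroup ((UnitaryGroup.cmDatum L 2 (Matrix.of fun i j : Fin 2 => if i.val + j.val + 1 = 2 then (1 : L) else 0)).Local v ×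
      (UnitaryGroup.cmDatum L 1 (Matrix.of fun i j : Fin 1 => if i.val + j.val + 1 = 1 then (1 : L) else 0)).Local v)) : Set ((UnitaryGroup.cmDatum L 2 (Matrix.of fun i j : Fin 2 => if i.val + j.val + 1 = 2 then (1 : L) else 0)).Local v ×
      (UnitaryGroup.cmDatum L 1 (Matrix.of fun i j : Fin 1 => if i.val + j.val + 1 = 1 then (1 : L) else 0)).Local v)).indicator fun _ => (1 : ℂ)) (ConjClasses.mk γH) =
      (((∫⁻ z, descConj (⟨(p : GL (Fin 3) (w.1.adicCompletion L)), hpM⟩ : ↥(standardLeviGL (w.1.adicCompletion L) (fun i : Fin 3 => decide (2 ≤ (i : ℕ)))))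
              ((Subgroup.centralizer ({(p : GL (Fin 3) (w.1.adicCompletion L))} : Set (GL (Fin 3) (w.1.adicCompletion L)))).subgroupOf
      (standardLeviGL (w.1.adicCompletion L) (fun i : Fin 3 => decide (2 ≤ (i : ℕ)))))
              (fun _ hs => Subtype.ext (Subgroup.mem_centralizer_singleton_iff.1 hs))
              (fun m : ↥(standardLeviGL (w.1.adicCompletion L) (fun i : Fin 3 => decide (2 ≤ (i : ℕ)))) =>
                (glInt 3 (w.1.adicCompletion L) : Set (GL (Fin 3) (w.1.adicCompletion L))).indicator (fun _ => (1 : ℝ≥0∞))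
                  (m : GL (Fin 3) (w.1.adicCompletion L)))
              z ∂(quotientMeasure _ tM (isClosed_subgroupOf _ _ hT) νM)).toReal : ℝ) : ℂ) := by
  -- (0) the Levi point: regularity, centraliser inside `M`
  have hregGL : IsRegularElt (UnitaryGroup.reindexGL finSumFinEquiv (UnitaryGroup.blockDiagGL (e₂ γH.1, e₁ γH.2))) := by
    refine isRegularElt_of_isConj (isConj_endoGL_reindexGL_blockDiagGL (e₂ γH.1, e₁ γH.2)) ?_
    rw [he₂, he₁]
    exact isRegularElt_endoGL_of_isLocalGRegular_of_split L (IsCMField.complexConj_ne_one L) w hw _ _ _ _ γH hreg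
  have hdet := det_sub_ne_zero_of_isRegularElt_reindexGL_blockDiagGL 2 finSumFinEquiv (e₂ γH.1) (e₁ γH.2) hregGL
  have hTM : Subgroup.centralizer ({(p : GL (Fin 3) (w.1.adicCompletion L))} : Set (GL (Fin 3) (w.1.adicCompletion L))) ≤
      standardLeviGL (w.1.adicCompletion L) (fun i : Fin 3 => decide (2 ≤ (i : ℕ))) := by
    rw [hpH]; exact centralizer_le_standardLeviGL_of_det_sub_ne_zero 2 (e₂ γH.1) (e₁ γH.2) hdet
  -- (1) read the class orbital integral at the point `γ_H`
  have hKo : IsOpen (((UnitaryGroup.cmLocalIntegralLevel L 2 (Matrix.of fun i j : Fin 2 => if i.val + j.val + 1 = 2 then (1 : L) else 0) v).prod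
        (UnitaryGroup.cmLocalIntegralLevel L 1 (Matrix.of fun i j : Fin 1 => if i.val + j.val + 1 = 1 then (1 : L) else 0) v) : Subgroup ((UnitaryGroup.cmDatum L 2 (Matrix.of fun i j : Fin 2 => if i.val + j.val + 1 = 2 then (1 : L) else 0)).Local v ×
      (UnitaryGroup.cmDatum L 1 (Matrix.of fun i j : Fin 1 => if i.val + j.val + 1 = 1 then (1 : L) else 0)).Local v)) : Set ((UnitaryGroup.cmDatum L 2 (Matrix.of fun i j : Fin 2 => if i.val + j.val + 1 = 2 then (1 : L) else 0)).Local v ×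
      (UnitaryGroup.cmDatum L 1 (Matrix.of fun i j : Fin 1 => if i.val + j.val + 1 = 1 then (1 : L) else 0)).Local v)) := by
    rw [Subgroup.coe_prod]
    exact (UnitaryGroup.isCompact_isOpen_cmLocalIntegralLevel L 2 _ v).2.prod (UnitaryGroup.isCompact_isOpen_cmLocalIntegralLevel L 1 _ v).2
  have hout : IsLocalGRegular L v (Quotient.out (ConjClasses.mk γH)) := isLocalGRegular_out_mk hreg
  haveI := hmH.isAdmissibleOn.smulInvariantMeasure (c := ConjClasses.mk γH) hout
  obtain ⟨tH, htH, htHi, htH1, hat⟩ := hmH.atPoint_eq_quotientMeasure γH hout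
  rw [← OrbitalMeasureFamily.orbitalIntegral_atPoint mH γH, hat, orbitalIntegral_indicator_eq_ofReal_toReal_lintegral γH _ hKo]
  refine congrArg (fun r : ℝ≥0∞ => ((r.toReal : ℝ) : ℂ)) ?_
  -- (2) instances
  haveI hCγ : IsClosed ((Subgroup.centralizer ({γH} : Set ((UnitaryGroup.cmDatum L 2 (Matrix.of fun i j : Fin 2 => if i.val + j.val + 1 = 2 then (1 : L) else 0)).Local v ×
      (UnitaryGroup.cmDatum L 1 (Matrix.of fun i j : Fin 1 => if i.val + j.val + 1 = 1 then (1 : L) else 0)).Local v)) : Subgroup ((UnitaryGroup.cmDatum L 2 (Matrix.of fun i j : Fin 2 => if i.val + j.val + 1 = 2 then (1 : L) else 0)).Local v ×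
      (UnitaryGroup.cmDatum L 1 (Matrix.of fun i j : Fin 1 => if i.val + j.val + 1 = 1 then (1 : L) else 0)).Local v)) : Set ((UnitaryGroup.cmDatum L 2 (Matrix.of fun i j : Fin 2 => if i.val + j.val + 1 = 2 then (1 : L) else 0)).Local v ×
      (UnitaryGroup.cmDatum L 1 (Matrix.of fun i j : Fin 1 => if i.val + j.val + 1 = 1 then (1 : L) else 0)).Local v)) :=
    isClosed_coe_centralizer_singleton γH
  haveI : LocallyCompactSpace (Subgroup.centralizer ({γH} : Set ((UnitaryGroup.cmDatum L 2 (Matrix.of fun i j : Fin 2 => if i.val + j.val + 1 = 2 then (1 : L) else 0)).Local v ×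
      (UnitaryGroup.cmDatum L 1 (Matrix.of fun i j : Fin 1 => if i.val + j.val + 1 = 1 then (1 : L) else 0)).Local v))) := hCγ.isClosedEmbedding_subtypeVal.locallyCompactSpace
  haveI : SecondCountableTopology (Subgroup.centralizer ({γH} : Set ((UnitaryGroup.cmDatum L 2 (Matrix.of fun i j : Fin 2 => if i.val + j.val + 1 = 2 then (1 : L) else 0)).Local v ×
      (UnitaryGroup.cmDatum L 1 (Matrix.of fun i j : Fin 1 => if i.val + j.val + 1 = 1 then (1 : L) else 0)).Local v))) := TopologicalSpace.Subtype.secondCountableTopology _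
  haveI := htH
  haveI := htHi
  haveI : BorelSpace ↥(standardLeviGL (w.1.adicCompletion L) (fun i : Fin 3 => decide (2 ≤ (i : ℕ)))) := Subtype.borelSpace _
  haveI : BorelSpace ↥((Subgroup.centralizer ({(p : GL (Fin 3) (w.1.adicCompletion L))} : Set (GL (Fin 3) (w.1.adicCompletion L)))).subgroupOf
      (standardLeviGL (w.1.adicCompletion L) (fun i : Fin 3 => decide (2 ≤ (i : ℕ))))) := Subtype.borelSpace _
  haveI hTMc : IsClosed ((((Subgroup.centralizer ({(p : GL (Fin 3) (w.1.adicCompletion L))} : Set (GL (Fin 3) (w.1.adicCompletion L)))).subgroupOf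
      (standardLeviGL (w.1.adicCompletion L) (fun i : Fin 3 => decide (2 ≤ (i : ℕ))))) :
      Subgroup ↥(standardLeviGL (w.1.adicCompletion L) (fun i : Fin 3 => decide (2 ≤ (i : ℕ))))) : Set ↥(standardLeviGL (w.1.adicCompletion L) (fun i : Fin 3 => decide (2 ≤ (i : ℕ))))) := isClosed_subgroupOf _ _ hT
  haveI : LocallyCompactSpace ↥((Subgroup.centralizer ({(p : GL (Fin 3) (w.1.adicCompletion L))} : Set (GL (Fin 3) (w.1.adicCompletion L)))).subgroupOf
      (standardLeviGL (w.1.adicCompletion L) (fun i : Fin 3 => decide (2 ≤ (i : ℕ))))) := hTMc.isClosedEmbedding_subtypeVal.locallyCompactSpace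
  haveI : SecondCountableTopology ↥((Subgroup.centralizer ({(p : GL (Fin 3) (w.1.adicCompletion L))} : Set (GL (Fin 3) (w.1.adicCompletion L)))).subgroupOf
      (standardLeviGL (w.1.adicCompletion L) (fun i : Fin 3 => decide (2 ≤ (i : ℕ))))) := TopologicalSpace.Subtype.secondCountableTopology _
  -- (3) the frame `j̃ = eM ∘ (e₂ × e₁) : H_v ≃ M` (★ B4′)
  obtain ⟨eM, heM⟩ : ∃ eM : (GL (Fin 2) (w.1.adicCompletion L) × GL (Fin 1) (w.1.adicCompletion L)) ≃ₜ* ↥(standardLeviGL (w.1.adicCompletion L) (fun i : Fin 3 => decide (2 ≤ (i : ℕ)))),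
      ∀ x, ((eM x : ↥(standardLeviGL (w.1.adicCompletion L) (fun i : Fin 3 => decide (2 ≤ (i : ℕ))))) : GL (Fin 3) (w.1.adicCompletion L)) = UnitaryGroup.reindexGL finSumFinEquiv (UnitaryGroup.blockDiagGL x) :=
    exists_continuousMulEquiv_prod_standardLeviGL_twoBlock (w.1.adicCompletion L) 2 1
  let jt : ((UnitaryGroup.cmDatum L 2 (Matrix.of fun i j : Fin 2 => if i.val + j.val + 1 = 2 then (1 : L) else 0)).Local v ×
      (UnitaryGroup.cmDatum L 1 (Matrix.of fun i j : Fin 1 => if i.val + j.val + 1 = 1 then (1 : L) else 0)).Local v) ≃* ↥(standardLeviGL (w.1.adicCompletion L) (fun i : Fin 3 => decide (2 ≤ (i : ℕ)))) := (MulEquiv.prodCongr e₂.toMulEquiv e₁.toMulEquiv).trans eM.toMulEquiv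
  have hjt : ∀ y, jt y = eM (e₂ y.1, e₁ y.2) := fun y => rfl
  have hj : Continuous jt := eM.continuous.comp (e₂.continuous.prodMap e₁.continuous)
  have hj' : Continuous jt.symm := (e₂.symm.continuous.prodMap e₁.symm.continuous).comp eM.symm.continuous
  have hjγ : jt γH = ⟨(p : GL (Fin 3) (w.1.adicCompletion L)), hpM⟩ := Subtype.ext (by rw [hjt, heM, hpH])
  have hTTj : ∀ x, jt x ∈ (Subgroup.centralizer ({(p : GL (Fin 3) (w.1.adicCompletion L))} : Set (GL (Fin 3) (w.1.adicCompletion L)))).subgroupOf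
      (standardLeviGL (w.1.adicCompletion L) (fun i : Fin 3 => decide (2 ≤ (i : ℕ)))) ↔ x ∈ Subgroup.centralizer ({γH} : Set ((UnitaryGroup.cmDatum L 2 (Matrix.of fun i j : Fin 2 => if i.val + j.val + 1 = 2 then (1 : L) else 0)).Local v ×
      (UnitaryGroup.cmDatum L 1 (Matrix.of fun i j : Fin 1 => if i.val + j.val + 1 = 1 then (1 : L) else 0)).Local v)) := fun x => by
    rw [← mulEquiv_apply_mem_centralizer_singleton_iff jt γH x, Subgroup.mem_subgroupOf, Subgroup.mem_centralizer_singleton_iff,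
      Subgroup.mem_centralizer_singleton_iff, hjγ, Subtype.ext_iff]
    rfl
  -- (4) `j̃(K_H) = M ∩ GL₃(𝒪_w)`
  have hmemj : ∀ y : ((UnitaryGroup.cmDatum L 2 (Matrix.of fun i j : Fin 2 => if i.val + j.val + 1 = 2 then (1 : L) else 0)).Local v ×
      (UnitaryGroup.cmDatum L 1 (Matrix.of fun i j : Fin 1 => if i.val + j.val + 1 = 1 then (1 : L) else 0)).Local v),
      ((jt y : ↥(standardLeviGL (w.1.adicCompletion L) (fun i : Fin 3 => decide (2 ≤ (i : ℕ))))) : GL (Fin 3) (w.1.adicCompletion L)) ∈ glInt 3 (w.1.adicCompletion L) ↔ y ∈ ((UnitaryGroup.cmLocalIntegralLevel L 2 (Matrix.of fun i j : Fin 2 => if i.val + j.val + 1 = 2 then (1 : L) else 0) v).prod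
        (UnitaryGroup.cmLocalIntegralLevel L 1 (Matrix.of fun i j : Fin 1 => if i.val + j.val + 1 = 1 then (1 : L) else 0) v) : Subgroup ((UnitaryGroup.cmDatum L 2 (Matrix.of fun i j : Fin 2 => if i.val + j.val + 1 = 2 then (1 : L) else 0)).Local v ×
      (UnitaryGroup.cmDatum L 1 (Matrix.of fun i j : Fin 1 => if i.val + j.val + 1 = 1 then (1 : L) else 0)).Local v)) := fun y => by
    have hK2 : ∀ a, e₂ a ∈ glInt 2 (w.1.adicCompletion L) ↔
        a ∈ UnitaryGroup.cmLocalIntegralLevel L 2 (Matrix.of fun i j : Fin 2 => if i.val + j.val + 1 = 2 then (1 : L) else 0) v :=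
      fun a => by
        rw [he₂]
        exact (mem_localIntegralLevel_iff_of_ne (IsCMField.complexConj L) 2 _ (IsCMField.complexConj_ne_one L) _ w hw _
          (unit_placeForm_antidiagOne_mem_glInt 2 w.1) a).symm
    have hK1 : ∀ b, e₁ b ∈ glInt 1 (w.1.adicCompletion L) ↔
        b ∈ UnitaryGroup.cmLocalIntegralLevel L 1 (Matrix.of fun i j : Fin 1 => if i.val + j.val + 1 = 1 then (1 : L) else 0) v :=
      fun b => by
        rw [he₁]
        exact (mem_localIntegralLevel_iff_of_ne (IsCMField.complexConj L) 1 _ (IsCMField.complexConj_ne_one L) _ w hw _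
          (unit_placeForm_antidiagOne_mem_glInt 1 w.1) b).symm
    rw [hjt, heM]
    refine (reindexGL_finSumFinEquiv_blockDiagGL_mem_glInt_iff (k := 2) (l := 1) (e₂ y.1, e₁ y.2)).trans ?_
    rw [Subgroup.mem_prod]
    exact and_congr (hK2 y.1) (hK1 y.2)
  have hindj : (fun m : ↥(standardLeviGL (w.1.adicCompletion L) (fun i : Fin 3 => decide (2 ≤ (i : ℕ)))) =>
      (glInt 3 (w.1.adicCompletion L) : Set (GL (Fin 3) (w.1.adicCompletion L))).indicator (fun _ => (1 : ℝ≥0∞)) (m : GL (Fin 3) (w.1.adicCompletion L))) ∘ ⇑jt =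
      (((UnitaryGroup.cmLocalIntegralLevel L 2 (Matrix.of fun i j : Fin 2 => if i.val + j.val + 1 = 2 then (1 : L) else 0) v).prod
        (UnitaryGroup.cmLocalIntegralLevel L 1 (Matrix.of fun i j : Fin 1 => if i.val + j.val + 1 = 1 then (1 : L) else 0) v) : Subgroup ((UnitaryGroup.cmDatum L 2 (Matrix.of fun i j : Fin 2 => if i.val + j.val + 1 = 2 then (1 : L) else 0)).Local v ×
      (UnitaryGroup.cmDatum L 1 (Matrix.of fun i j : Fin 1 => if i.val + j.val + 1 = 1 then (1 : L) else 0)).Local v)) : Set ((UnitaryGroup.cmDatum L 2 (Matrix.of fun i j : Fin 2 => if i.val + j.val + 1 = 2 then (1 : L) else 0)).Local v ×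
      (UnitaryGroup.cmDatum L 1 (Matrix.of fun i j : Fin 1 => if i.val + j.val + 1 = 1 then (1 : L) else 0)).Local v)).indicator fun _ => (1 : ℝ≥0∞) := by
    funext y
    simp only [Function.comp_apply]
    by_cases hy : y ∈ ((UnitaryGroup.cmLocalIntegralLevel L 2 (Matrix.of fun i j : Fin 2 => if i.val + j.val + 1 = 2 then (1 : L) else 0) v).prod
        (UnitaryGroup.cmLocalIntegralLevel L 1 (Matrix.of fun i j : Fin 1 => if i.val + j.val + 1 = 1 then (1 : L) else 0) v) : Subgroup ((UnitaryGroup.cmDatum L 2 (Matrix.of fun i j : Fin 2 => if i.val + j.val + 1 = 2 then (1 : L) else 0)).Local v ×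
      (UnitaryGroup.cmDatum L 1 (Matrix.of fun i j : Fin 1 => if i.val + j.val + 1 = 1 then (1 : L) else 0)).Local v))
    · rw [Set.indicator_of_mem (show ((jt y : ↥(standardLeviGL (w.1.adicCompletion L) (fun i : Fin 3 => decide (2 ≤ (i : ℕ))))) : GL (Fin 3) (w.1.adicCompletion L)) ∈
          (glInt 3 (w.1.adicCompletion L) : Set (GL (Fin 3) (w.1.adicCompletion L))) from (hmemj y).2 hy),
        Set.indicator_of_mem (show y ∈ ((((UnitaryGroup.cmLocalIntegralLevel L 2 (Matrix.of fun i j : Fin 2 => if i.val + j.val + 1 = 2 then (1 : L) else 0) v).prod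
        (UnitaryGroup.cmLocalIntegralLevel L 1 (Matrix.of fun i j : Fin 1 => if i.val + j.val + 1 = 1 then (1 : L) else 0) v) : Subgroup ((UnitaryGroup.cmDatum L 2 (Matrix.of fun i j : Fin 2 => if i.val + j.val + 1 = 2 then (1 : L) else 0)).Local v ×
      (UnitaryGroup.cmDatum L 1 (Matrix.of fun i j : Fin 1 => if i.val + j.val + 1 = 1 then (1 : L) else 0)).Local v)) : Set ((UnitaryGroup.cmDatum L 2 (Matrix.of fun i j : Fin 2 => if i.val + j.val + 1 = 2 then (1 : L) else 0)).Local v ×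
      (UnitaryGroup.cmDatum L 1 (Matrix.of fun i j : Fin 1 => if i.val + j.val + 1 = 1 then (1 : L) else 0)).Local v))) from hy)]
    · rw [Set.indicator_of_notMem (show ((jt y : ↥(standardLeviGL (w.1.adicCompletion L) (fun i : Fin 3 => decide (2 ≤ (i : ℕ))))) : GL (Fin 3) (w.1.adicCompletion L)) ∉
          (glInt 3 (w.1.adicCompletion L) : Set (GL (Fin 3) (w.1.adicCompletion L))) from fun h => hy ((hmemj y).1 h)),
        Set.indicator_of_notMem (show y ∉ ((((UnitaryGroup.cmLocalIntegralLevel L 2 (Matrix.of fun i j : Fin 2 => if i.val + j.val + 1 = 2 then (1 : L) else 0) v).prod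
        (UnitaryGroup.cmLocalIntegralLevel L 1 (Matrix.of fun i j : Fin 1 => if i.val + j.val + 1 = 1 then (1 : L) else 0) v) : Subgroup ((UnitaryGroup.cmDatum L 2 (Matrix.of fun i j : Fin 2 => if i.val + j.val + 1 = 2 then (1 : L) else 0)).Local v ×
      (UnitaryGroup.cmDatum L 1 (Matrix.of fun i j : Fin 1 => if i.val + j.val + 1 = 1 then (1 : L) else 0)).Local v)) : Set ((UnitaryGroup.cmDatum L 2 (Matrix.of fun i j : Fin 2 => if i.val + j.val + 1 = 2 then (1 : L) else 0)).Local v ×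
      (UnitaryGroup.cmDatum L 1 (Matrix.of fun i j : Fin 1 => if i.val + j.val + 1 = 1 then (1 : L) else 0)).Local v))) from hy)]
  -- (5) the transported Haar measures ARE `ν_M` and `t_M`
  haveI : (Measure.map jt νH).IsHaarMeasure := MulEquiv.isHaarMeasure_map νH jt hj hj'
  have hMK : MeasurableSet (Subtype.val ⁻¹' (glInt 3 (w.1.adicCompletion L) : Set (GL (Fin 3) (w.1.adicCompletion L))) : Set ↥(standardLeviGL (w.1.adicCompletion L) (fun i : Fin 3 => decide (2 ≤ (i : ℕ))))) :=
    ((isOpen_glInt 3 (w.1.adicCompletion L)).preimage continuous_subtype_val).measurableSet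
  have hνMj : νM = Measure.map jt νH := by
    refine isHaarMeasure_eq_of_apply_eq νM _ (s := Subtype.val ⁻¹' (glInt 3 (w.1.adicCompletion L) : Set (GL (Fin 3) (w.1.adicCompletion L)))) ?_ ?_ ?_
    · rw [Measure.map_apply hj.measurable hMK]
      have hpre : ⇑jt ⁻¹' (Subtype.val ⁻¹' (glInt 3 (w.1.adicCompletion L) : Set (GL (Fin 3) (w.1.adicCompletion L)))) = (((UnitaryGroup.cmLocalIntegralLevel L 2 (Matrix.of fun i j : Fin 2 => if i.val + j.val + 1 = 2 then (1 : L) else 0) v).prod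
        (UnitaryGroup.cmLocalIntegralLevel L 1 (Matrix.of fun i j : Fin 1 => if i.val + j.val + 1 = 1 then (1 : L) else 0) v) : Subgroup ((UnitaryGroup.cmDatum L 2 (Matrix.of fun i j : Fin 2 => if i.val + j.val + 1 = 2 then (1 : L) else 0)).Local v ×
      (UnitaryGroup.cmDatum L 1 (Matrix.of fun i j : Fin 1 => if i.val + j.val + 1 = 1 then (1 : L) else 0)).Local v)) : Set ((UnitaryGroup.cmDatum L 2 (Matrix.of fun i j : Fin 2 => if i.val + j.val + 1 = 2 then (1 : L) else 0)).Local v ×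
      (UnitaryGroup.cmDatum L 1 (Matrix.of fun i j : Fin 1 => if i.val + j.val + 1 = 1 then (1 : L) else 0)).Local v)) :=
        Set.ext fun y => hmemj y
      rw [hpre, hKH]; exact one_ne_zero
    · rw [Measure.map_apply hj.measurable hMK]
      have hpre : ⇑jt ⁻¹' (Subtype.val ⁻¹' (glInt 3 (w.1.adicCompletion L) : Set (GL (Fin 3) (w.1.adicCompletion L)))) = (((UnitaryGroup.cmLocalIntegralLevel L 2 (Matrix.of fun i j : Fin 2 => if i.val + j.val + 1 = 2 then (1 : L) else 0) v).prod
        (UnitaryGroup.cmLocalIntegralLevel L 1 (Matrix.of fun i j : Fin 1 => if i.val + j.val + 1 = 1 then (1 : L) else 0) v) : Subgroup ((UnitaryGroup.cmDatum L 2 (Matrix.of fun i j : Fin 2 => if i.val + j.val + 1 = 2 then (1 : L) else 0)).Local v ×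
      (UnitaryGroup.cmDatum L 1 (Matrix.of fun i j : Fin 1 => if i.val + j.val + 1 = 1 then (1 : L) else 0)).Local v)) : Set ((UnitaryGroup.cmDatum L 2 (Matrix.of fun i j : Fin 2 => if i.val + j.val + 1 = 2 then (1 : L) else 0)).Local v ×
      (UnitaryGroup.cmDatum L 1 (Matrix.of fun i j : Fin 1 => if i.val + j.val + 1 = 1 then (1 : L) else 0)).Local v)) :=
        Set.ext fun y => hmemj y
      rw [hpre, hKH]; exact ENNReal.one_ne_top
    · rw [hνM, Measure.map_apply hj.measurable hMK]
      have hpre : ⇑jt ⁻¹' (Subtype.val ⁻¹' (glInt 3 (w.1.adicCompletion L) : Set (GL (Fin 3) (w.1.adicCompletion L)))) = (((UnitaryGroup.cmLocalIntegralLevel L 2 (Matrix.of fun i j : Fin 2 => if i.val + j.val + 1 = 2 then (1 : L) else 0) v).prod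
        (UnitaryGroup.cmLocalIntegralLevel L 1 (Matrix.of fun i j : Fin 1 => if i.val + j.val + 1 = 1 then (1 : L) else 0) v) : Subgroup ((UnitaryGroup.cmDatum L 2 (Matrix.of fun i j : Fin 2 => if i.val + j.val + 1 = 2 then (1 : L) else 0)).Local v ×
      (UnitaryGroup.cmDatum L 1 (Matrix.of fun i j : Fin 1 => if i.val + j.val + 1 = 1 then (1 : L) else 0)).Local v)) : Set ((UnitaryGroup.cmDatum L 2 (Matrix.of fun i j : Fin 2 => if i.val + j.val + 1 = 2 then (1 : L) else 0)).Local v ×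
      (UnitaryGroup.cmDatum L 1 (Matrix.of fun i j : Fin 1 => if i.val + j.val + 1 = 1 then (1 : L) else 0)).Local v)) :=
        Set.ext fun y => hmemj y
      rw [hpre, hKH]
  let φH := subgroupCongrHomeomorph jt (Subgroup.centralizer ({γH} : Set ((UnitaryGroup.cmDatum L 2 (Matrix.of fun i j : Fin 2 => if i.val + j.val + 1 = 2 then (1 : L) else 0)).Local v ×
      (UnitaryGroup.cmDatum L 1 (Matrix.of fun i j : Fin 1 => if i.val + j.val + 1 = 1 then (1 : L) else 0)).Local v))) ((Subgroup.centralizer ({(p : GL (Fin 3) (w.1.adicCompletion L))} : Set (GL (Fin 3) (w.1.adicCompletion L)))).subgroupOf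
      (standardLeviGL (w.1.adicCompletion L) (fun i : Fin 3 => decide (2 ≤ (i : ℕ))))) hTTj hj hj'
  haveI : (Measure.map φH tH).IsHaarMeasure := isHaarMeasure_map_subgroupCongrHomeomorph _ _ _ _ _ _ tH
  have hφ1 : (Measure.map φH tH) (compactCore _) = 1 :=
    map_apply_compactCore_eq_one_of_homeomorph φH
      (fun a b => Subtype.ext (by simp only [φH, coe_subgroupCongrHomeomorph_apply, Subgroup.coe_mul, map_mul])) tH htH1
  have htMj : tM = Measure.map φH tH :=
    isHaarMeasure_eq_of_apply_eq tM _ (by rw [hφ1]; exact one_ne_zero) (by rw [hφ1]; exact ENNReal.one_ne_top) (by rw [htM, hφ1])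
  -- (6) transport along `j̃`
  have hC := lintegral_descConj_quotientMeasure_eq_of_mulEquiv_of_eq jt hj hj' (Subgroup.centralizer ({γH} : Set ((UnitaryGroup.cmDatum L 2 (Matrix.of fun i j : Fin 2 => if i.val + j.val + 1 = 2 then (1 : L) else 0)).Local v ×
      (UnitaryGroup.cmDatum L 1 (Matrix.of fun i j : Fin 1 => if i.val + j.val + 1 = 1 then (1 : L) else 0)).Local v)))
    ((Subgroup.centralizer ({(p : GL (Fin 3) (w.1.adicCompletion L))} : Set (GL (Fin 3) (w.1.adicCompletion L)))).subgroupOf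
      (standardLeviGL (w.1.adicCompletion L) (fun i : Fin 3 => decide (2 ≤ (i : ℕ))))) hTTj tH tM νH νM htMj hνMj hjγ
    (fun _ hg => Subgroup.mem_centralizer_singleton_iff.1 hg) (fun _ hs => Subtype.ext (Subgroup.mem_centralizer_singleton_iff.1 hs))
    (fun m : ↥(standardLeviGL (w.1.adicCompletion L) (fun i : Fin 3 => decide (2 ≤ (i : ℕ)))) =>
      (glInt 3 (w.1.adicCompletion L) : Set (GL (Fin 3) (w.1.adicCompletion L))).indicator (fun _ => (1 : ℝ≥0∞)) (m : GL (Fin 3) (w.1.adicCompletion L)))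
  rw [hindj] at hC
  exact hC.symm

end HSide

end Split

end Literature.NumberTheory.Rogawski1990

end
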